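import Summits.CriticalPhenomena.SAWScalingLimit.Theses.SAWRenewalTightness
import Summits.CriticalPhenomena.SAWScalingLimit.Theorems.TubeLowerBound.Negative.TubeLowerBoundLoadBearing
import Summits.CriticalPhenomena.SAWScalingLimit.Theorems.TubeLowerBound.Negative.TubeLowerBoundFixedWidth

/-!
# Line `lieb-simon-star` — skeleton for the crux `SAWRenewalTightness.TubeLowerBound`
(crux item stmt-CriticalPhenomena-4730, rank 4 of `route-CriticalPhenomena-SAWRenewalTightness`; crux-plan round 1;
idea card `Cruxes/TubeLowerBound/Ideas/lieb-simon-star.md` (merged by the panel with `simon-lieb-mirror-fan`);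
triage r1-2: pass, r1-3: pass — sharpenings answered in `Lines/lieb-simon-star.md`)

Crux (FIXED, by name): `TubeLowerBound` — there are `C` and `c > 0` such that for all `u v ∈ ℤ²` and `ℓ ≥ 1` with
`|u − v| ≤ ℓ` some partial sum of the `x_c`-mass of self-avoiding walks `u → v` whose vertices stay within `ℓ/10 + 2`
of the segment `[u, v]` is `≥ c ℓ^{−C}`.  ALL directions `v − u`.

## The line (4 registered stubs, glued by the kernel-checked `TubeLowerBound_of`)

The idea card has two halves.  (i) The Simon–Lieb half — `θ_S(x_c) ≥ 1` for every finite `S ∋ 0`, a quarter of it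
through each side of a centred box, and the reflect-and-Schwarz DOMINO floor — is a set of THEOREMS (triage r1-2/r1-3
checked them by hand and numerically); they are typed below as MILESTONES (`LiebSimonFloor`, `QuarterFlux`,
`DominoFloor`), not registered: a bulk star occupies a full box around its endpoint, so it cannot sit at a corner of a
staircase (it meets the next piece) and no lattice symmetry isolates a sub-side of it — no all-direction composition can
consume the stars (planner's NOTES, "Design decision").  (ii) The card's reduction "thin tube ⇐ ONE rectangle-crossing
floor by a rectangle chain + one Schwarz about the bisector" is what this skeleton builds, with two sharpenings that make
it reach EVERY direction and weaken its input:

* S1 `stub_cornerCrossingFloor` (OPEN, HARDEST — the RSW-type input; the card's `RectCrossingFloor` with the entry point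
  weakened from "uniform over the west side, corners included" to "the CORNER only", and the aspect made existential):
  `∃ K C c, ∀ a ≥ 1`: the `x_c`-mass of SAWs from the south-west corner `(0,0)` of the closed rectangle
  `[0, a] × [0, K a]` that stay in it and whose last vertex lies on the east column `x = a` is `≥ c a^{−C}` (some
  partial sum).  Point-to-LINE, one scale, one direction, no second endpoint, aspect free; predicted `≍ a^{−7/8}`
  (π/2-corner boundary exponent `5/4` + far-side exponent `5/8`, Cardy 1984); not implied by the crux (lateral transfer,
  triage r1-3 CORRECTION) and not finitely refutable.
* S2 `stub_steeredChain` (provable now, M–L): S1 ⇒ `OneSidedReach` — from the corner of the FLAT box `[0, X] × [0, X/5]`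
  to its east column, `≥ c X^{−C}`, for every `X ≥ 1`.  Mechanism (ONE-SIDED SIGN STEERING, the new device): chain
  `k = 10K + 1` rectangles of widths `a` or `a + 1` eastwards, consecutive rectangles in disjoint column ranges joined by one
  east edge; rectangle `i` is placed with the current point at its SW corner if the current height `y < H_i = K a_i`,
  else at its NW corner (the NW family is the `y ↦ −y` mirror of the SW family, same mass): heights never leave
  `[0, 2K(a+1)] ⊆ [0, X/5]`, the chain never dips below its starting row, and the mass multiplies
  (`≥ x_c^{k−1} ∏ c a_i^{−C}`), `k` FIXED because heights scale with widths — exactly the widening that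
  `Negative.not_withoutDist` demands.  Widths `a`/`a+1` realise every `X ≥ 2k − 1`; smaller `X`: the straight walk.
* S3 `stub_mirrorPin` (provable now, M): `OneSidedReach` ⇒ `HalfTubePieceFloor` — POINTWISE corner-to-corner pieces:
  SAWs `(0,0) → (L,0)` inside the closed half-tube `[0, L] × [0, L/10]`, `≥ c L^{−C}` for every `L ≥ 1`.  Mechanism
  (Madras–Slade Lemma 4.1.12, reflect-and-Schwarz, applied ONCE): a one-sided half-walk to column `X`, one (odd `L`) or
  two (even `L`) bridging edges, and the reversed mirror image in `x = L/2` of a second half-walk with the SAME end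
  height; halves live in disjoint column ranges (self-avoiding, injective), Cauchy–Schwarz over the `⌊X/5⌋ + 1 ≤ X + 1`
  end heights: `mass(L) ≥ x_c² (c X^{−C})² / (X + 1)`.
* S4 `stub_cornerStaircase` (provable now, L): `HalfTubePieceFloor` ⇒ `TightTubeFloor` (the crux at its own scale
  `ℓ₀ = max(1, |u − v|)`, all directions).  Mechanism (FREE CORNERS FOR ONE-SIDED FLAT PIECES — refines triage F1, which
  granted free corners to tapered pieces only): WLOG `u = 0`, `v = (a, b)`, `0 ≤ b ≤ a` (dihedral symmetry + translation);
  `n = 20` rounds through the lattice points `Q_j = (⌊ja/n⌋, ⌊jb/n⌋)`: a horizontal piece ABOVE its leg from `Q_{j−1}`,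
  one east edge, a vertical piece (coordinate swap of a horizontal one) to the RIGHT of its leg, one north edge to `Q_j`.
  Every horizontal piece lies in columns `[x_{j−1}, x_j − 1]`, every vertical one in columns `[x_j, x_{j+1} − 1]` and rows
  `[y_{j−1}, y_j − 1]`, the next horizontal one in rows `≥ y_j`: all pieces are pairwise disjoint by column or row
  separation, so the concatenation is self-avoiding and injective (corners are prescribed lattice points).  Tube: vertical
  distance to the segment `≤ 1.1 a/n + 1 ≤ |v|/10 + 2`.  Mass `≥ (x_c min(c,1))^{2n} (2ℓ₀)^{−2nC}`.  Small `a < n`: the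
  digital staircase (distance `< 2`, mass `x_c^{a+b}`).
* `TubeLowerBound_of : TubeLowerBound` — kernel-checked composition (no `sorry` of its own): S1–S4 give `TightTubeFloor`,
  and monotonicity in `ℓ` (the tube only widens, `c ℓ^{−C}` only shrinks for `C ≥ 0`) gives the crux BY NAME.

Every stub is stated over TREE VOCABULARY plus the local `def`s of this file (`Zd.saws`, `Zd.sawFun`,
`criticalFugacity`, `Site.toComplex`), all floors in the `∃ N` partial-sum form with `0 ≤ C`.

Disproof.lean (cdisprove cycle 1; landed as `Theorems/TubeLowerBound/Negative/TubeLowerBoundLoadBearing|FixedWidth`,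
both IMPORTED here) honoured: `not_atFugacity_of_lt` (criticality load-bearing) — the line uses `x = x_c` at S1 only
(S2–S4 are fugacity-free injections, valid at any fugacity in `(0,1]`; the corner-crossing floor is false below `x_c` by
the refuter's own exponential decay); `not_withoutDist` (the tube must WIDEN) — used at S2 (rectangle heights `K a_i`
scale with the widths, so `k` is a constant; at fixed height the same chain needs `k ∝ X` pieces and decays exponentially,
the refuter's strip regime `m_W (W+1) ≈ π·5/8`) and at S3/S4 (piece heights `L/10`); `not_withoutSlack` — the `+2` is
kept in `TightTubeFloor` and spent on lattice rounding (`+1`) and the digital path (`< 2`); `constraints` /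
`exponent_eq_zero_of_withoutOneLe` — every def carries `0 ≤ C`, `TightTubeFloor` works at `ℓ₀ ≥ 1`; `not_allN` — `∃ N`
throughout; `twoPoint_floor` — consistent: `HalfTubePieceFloor` is a (confined) pointwise axis two-point floor, claimed
only downstream of the open S1.  No stub is an instance of a refuted variant (`examples` at the end of the file record the
two landed Negative modules the stubs were checked against); `ledger negatives --problem CriticalPhenomena`: nothing on
tube / two-point / crossing floors.
-/

noncomputable section

namespace Summit.CriticalPhenomena.SAWScalingLimit.Cruxes.TubeLowerBound.LiebSimonStar

open scoped BigOperators Classical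
open Literature.Probability.LatticeModels
open Literature.Probability.RandomPlanarGeometry Literature.Probability.RandomPlanarGeometry.SAW
open Summit.CriticalPhenomena.SAWScalingLimit.Theses.SAWRenewalTightness

set_option linter.unusedVariables false

/-! ## The statements of the line -/

/-- **S1 statement `CornerCrossingFloor`** (the ONE open input; the card's `RectCrossingFloor` with corner-only entry
and existential aspect).  There are `K : ℕ` and `C ≥ 0`, `c > 0` such that for every width `a ≥ 1` some partial sum of
the `x_c`-mass of self-avoiding walks `ω` from `0` — the south-west corner — all of whose vertices lie in the closed
rectangle `[0, a] × [0, K a]` and whose last vertex lies on the east column `x = a` is at least `c a^{−C}`.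
(Not first passage: earlier visits to the column `x = a` are allowed — the weakest form the chain needs.)
Heuristic value `≍ a^{−7/8} g(K)` (corner exponent `x(π/2) = 2·(5/8)`, Cardy; far side `5/8`).
Why it might fail: no lower-bound (RSW-type) technology for the critical SAW on `ℤ²` is in print (Madras–Slade 1993
p. 259); the hexagonal lattice has only the parafermionic bridge floor `B_T ≥ c/T` (`HexSAWLowerBound.lean`), which does
not see corners. [folklore] -/
def CornerCrossingFloor : Prop :=
  ∃ (K : ℕ) (C c : ℝ), 0 ≤ C ∧ 0 < c ∧ ∀ a : ℕ, 1 ≤ a → ∃ N : ℕ,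
    c * (a : ℝ) ^ (-C) ≤ ∑ n ∈ Finset.range (N + 1),
      ∑ _ω ∈ (Zd.saws 2 n).filter (fun ω =>
          (∀ i ≤ n, 0 ≤ ω i 0 ∧ ω i 0 ≤ (a : ℤ) ∧ 0 ≤ ω i 1 ∧ ω i 1 ≤ (K : ℤ) * a) ∧ ω n 0 = (a : ℤ)),
        criticalFugacity ^ n

/-- **`OneSidedReach`** (output of S2, input of S3): corner-to-column crossing of the FLAT box of aspect `5`.  There are
`C ≥ 0`, `c > 0` such that for every `X ≥ 1` some partial sum of the `x_c`-mass of self-avoiding walks from `0` all of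
whose vertices satisfy `0 ≤ x ≤ X`, `0 ≤ y`, `5 y ≤ X`, and whose last vertex lies on the column `x = X`, is at least
`c X^{−C}`.  (Formally STRONGER than S1's conclusion for any `K ≥ 1` — the content of S2 is the aspect upgrade.)
[folklore] -/
def OneSidedReach : Prop :=
  ∃ C c : ℝ, 0 ≤ C ∧ 0 < c ∧ ∀ X : ℕ, 1 ≤ X → ∃ N : ℕ,
    c * (X : ℝ) ^ (-C) ≤ ∑ n ∈ Finset.range (N + 1),
      ∑ _ω ∈ (Zd.saws 2 n).filter (fun ω =>
          (∀ i ≤ n, 0 ≤ ω i 0 ∧ ω i 0 ≤ (X : ℤ) ∧ 0 ≤ ω i 1 ∧ 5 * ω i 1 ≤ (X : ℤ)) ∧ ω n 0 = (X : ℤ)),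
        criticalFugacity ^ n

/-- **`HalfTubePieceFloor`** (output of S3, input of S4): POINTWISE one-sided flat pieces.  There are `C ≥ 0`, `c > 0`
such that for every `L ≥ 1` some partial sum of the `x_c`-mass of self-avoiding walks `0 → (L, 0)` all of whose vertices
lie in the closed half-tube `[0, L] × [0, L/10]` (`0 ≤ x ≤ L`, `0 ≤ y`, `10 y ≤ L`) is at least `c L^{−C}`.  Both
endpoints are CORNERS of the confining rectangle (predicted `≍ L^{−5/2}·O(1)`: two `π/2`-corner exponents `5/4`); the
piece never crosses its base row and never overshoots its end columns — the two properties the staircase S4 uses.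
[folklore] -/
def HalfTubePieceFloor : Prop :=
  ∃ C c : ℝ, 0 ≤ C ∧ 0 < c ∧ ∀ L : ℕ, 1 ≤ L → ∃ N : ℕ,
    c * (L : ℝ) ^ (-C) ≤ ∑ n ∈ Finset.range (N + 1),
      ∑ _ω ∈ (Zd.sawFun 2 n ![(L : ℤ), 0]).filter (fun ω =>
          ∀ i ≤ n, 0 ≤ ω i 0 ∧ ω i 0 ≤ (L : ℤ) ∧ 0 ≤ ω i 1 ∧ 10 * ω i 1 ≤ (L : ℤ)),
        criticalFugacity ^ n

/-- **`TightTubeFloor`** — the crux at its own scale (output of S4; same def as in `Lines/subcritical-renewal-floor.lean`):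
there are `C ≥ 0` and `c > 0` such that for all `u, v ∈ ℤ²`, with `ℓ₀ := max(1, |u − v|)`, some partial sum of the
`x_c`-mass of self-avoiding walks `u → v` all of whose vertices lie within `ℓ₀/10 + 2` of the segment `[u, v]` is
`≥ c ℓ₀^{−C}` (vocabulary of the crux: `Zd.sawFun`, `Metric.infDist`, `segment`, `Site.toComplex`).  `TubeLowerBound`
quantifies over every `ℓ ≥ ℓ₀` instead; the tube only widens and the bound only weakens with `ℓ`, and the easy direction
is the proved composition `TubeLowerBound_of`. [folklore] -/
def TightTubeFloor : Prop :=
  ∃ C c : ℝ, 0 ≤ C ∧ 0 < c ∧ ∀ (u v : Site 2), ∃ N : ℕ,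
    c * (max 1 (dist (Site.toComplex u) (Site.toComplex v))) ^ (-C) ≤
      ∑ n ∈ Finset.range (N + 1), ∑ _ω ∈ (Zd.sawFun 2 n (v - u)).filter (fun ω => ∀ i ≤ n,
          Metric.infDist (Site.toComplex (u + ω i)) (segment ℝ (Site.toComplex u) (Site.toComplex v)) ≤
            max 1 (dist (Site.toComplex u) (Site.toComplex v)) / 10 + 2),
        criticalFugacity ^ n

/-! ## Milestones — the idea's PROVED half (theorems of Simon–Lieb type; NOT registered, NOT consumed by the composition;
recorded with exact signatures so that they can be landed as Literature theorems / route support, triage r1-2 F3) -/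

/-- Sup-norm `max(|x|, |y|)` of a site of `ℤ²`. [folklore] -/
def supNorm (y : Site 2) : ℤ := max |y 0| |y 1|

/-- **`LiebSimonFloor`** (card A, sharpened as triage r1-2 (a) asked: no `ε`, the stopped sum is finite).  For every
`R ≥ 1` the `x_c`-mass of self-avoiding walks from `0` that stay in the open box `‖·‖∞ < R` before their last vertex and
whose last vertex lies on `‖·‖∞ = R` (first-exit walks; they have `≤ (2R−1)²` steps) is `≥ 1`.  Proof: otherwise cutting
every walk at its first exit of the box bounds the truncated susceptibility, `χ_N(x_c) ≤ C_R + θ χ_N(x_c)` with `θ < 1`,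
contradicting `Σ_{n ≤ N} c_n x_c^n ≥ N + 1` (`Zd.pow_connectiveConstant_le_count`).  The Lieb–Simon inequality
(Simon 1980, Lieb 1980; Madras–Slade 1993 Lemma A.1) run backwards at criticality; `φ_{β_c}(S) ≥ 1`-type statements:
Duminil-Copin–Tassion arXiv:1502.03050 (percolation/Ising), Duminil-Copin–Panis arXiv:2410.03649 (WSAW, `d > 4`).
[cite: MadrasSlade1993, Lemma A.1] -/
def LiebSimonFloor : Prop :=
  ∀ R : ℕ, 1 ≤ R → (1 : ℝ) ≤ ∑ n ∈ Finset.range ((2 * R - 1) ^ 2 + 1),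
    ∑ _ω ∈ (Zd.saws 2 n).filter (fun ω => (∀ i < n, supNorm (ω i) < (R : ℤ)) ∧ supNorm (ω n) = (R : ℤ)),
      criticalFugacity ^ n

/-- **`QuarterFlux`** (card A): the first-exit walks of the open `R`-box leaving through the EAST side `x = R` (corners
included) carry `x_c`-mass `≥ 1/4` — `LiebSimonFloor` plus the order-4 rotation symmetry of `(ℤ², box, x_c^{|ω|})`
(the four side-families have equal mass and cover all first-exit walks).  Exact enumeration (triage r1-2/r1-3, kit
j009782): `θ_R = 1.516, 1.784, 1.979` for `R = 1, 2, 3`, east share `= θ_R/4` exactly. [folklore] -/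
def QuarterFlux : Prop :=
  ∀ R : ℕ, 1 ≤ R → (1 : ℝ) / 4 ≤ ∑ n ∈ Finset.range ((2 * R - 1) ^ 2 + 1),
    ∑ _ω ∈ (Zd.saws 2 n).filter (fun ω => (∀ i < n, supNorm (ω i) < (R : ℤ)) ∧ ω n 0 = (R : ℤ)),
      criticalFugacity ^ n

/-- **`DominoFloor`** (card A; the idea's unconditional POINTWISE fat-tube floor on the axis, settling the consequence
`twoPoint_floor` of the crux on the lattice rays): for every `R ≥ 1` the `x_c`-mass of self-avoiding walks
`0 → (2R+1, 0)` confined to the domino `[−R, 3R+1] × [−R, R]` is `≥ x_c / (16 (2R+1))` — an east-exit fan of the `R`-box,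
one bridging edge, and the reversed mirror image in `x = R + 1/2` of a second east-exit fan with the same exit height;
Cauchy–Schwarz over the `2R+1` heights and `QuarterFlux`.  (Diagonal twin with `ℓ¹`-balls and the mirror `x + y = R + 1`.)
[cite: MadrasSlade1993, Lemma 4.1.12] -/
def DominoFloor : Prop :=
  ∀ R : ℕ, 1 ≤ R → criticalFugacity / (16 * (2 * (R : ℝ) + 1)) ≤
    ∑ n ∈ Finset.range (2 * (2 * R - 1) ^ 2 + 2),
      ∑ _ω ∈ (Zd.sawFun 2 n ![2 * (R : ℤ) + 1, 0]).filter
        (fun ω => ∀ i ≤ n, -(R : ℤ) ≤ ω i 0 ∧ ω i 0 ≤ 3 * (R : ℤ) + 1 ∧ |ω i 1| ≤ (R : ℤ)),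
      criticalFugacity ^ n

/-! ## Registered stubs (`sorry` only here) -/

/-- **S1 `stub_cornerCrossingFloor`** — `CornerCrossingFloor` (see the def): the HARDEST stub, the whole open content of
the line (an RSW-type polynomial LOWER bound at `x_c` for a corner-started, rectangle-confined point-to-line family).
Attack surfaces recorded for the lead: (a) monotonicity — the family grows with `K`, and appending one east step shows
the floor is needed only on a set of widths with bounded gaps; (b) its quadrant shadow (drop the height cap) is a
"quadrant bridge" class with a cone-nesting monoid structure (`wedge-bridge-monoid`, quadrant chart `f^Q`), so
supermultiplicativity in `a` is available there; (c) the Simon–Lieb milestones give the corner-to-ANY-side escape mass of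
every box cornered at `0` only together with the near sides, i.e. no floor — the honest wall of the idea.  Cheapest
falsifier: none finite (an `∃ C` asymptotic floor); sanity numerics = corner-vs-mid-side entry ratio of square crossings,
predicted `≍ a^{−5/8}` (card, falsifier (b)). -/
theorem stub_cornerCrossingFloor : CornerCrossingFloor := by
  sorry

/-- **S2 `stub_steeredChain`** — `CornerCrossingFloor → OneSidedReach` (one-sided sign steering; provable now, M–L).
Given `(K, C, c)` from S1 put `k := 10 K + 1`.  (1) SYMMETRY: the `y ↦ −y` image (`Zd.reflAt 1 0`) of S1's family is the
family of SAWs from the NORTH-west corner of `[0, a] × [−K a, 0]` ending on `x = a`, with the same partial sums.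
(2) CHAIN: for widths `a_1, …, a_k ∈ {a, a+1}` define recursively the family of walks
`ω_1 · e₁ · ω_2 · e₁ ⋯ e₁ · ω_k` where `ω_i` runs in the rectangle of width `a_i`, height `K a_i`, west column
`x_i = Σ_{j<i} (a_j + 1)`, placed with the current point `P` (the start `0`, resp. the east neighbour of the previous
exit point) at its SW corner if `P_y < K a_i` and at its NW corner otherwise: by induction every height stays in
`[0, 2K(a+1)]`, every vertex has `0 ≤ x ≤ X := Σ_i (a_i + 1) − 1`, consecutive pieces occupy the disjoint column ranges
`[x_i, x_i + a_i]`, so `Zd.concatWalk_mem_saws` applies (separation by columns), the map from tuples to chains is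
injective (cut at the first visits to the columns `x_i`), and summing the floors from the inside out gives partial mass
`≥ x_c^{k−1} ∏_i c a_i^{−C} ≥ x_c^{k−1} c^k (a+1)^{−kC}` at `N = Σ N(a_i) + k − 1`.  (3) FIT: `5 · 2K(a+1) ≤ X` because
`X ≥ k a + k − 1 = 10K(a+1) + a`; and `X` ranges over `[k(a+1) − 1, k(a+2) − 1]` as the widths vary, which for
`a = 1, 2, …` covers every `X ≥ 2k − 1`; for `1 ≤ X < 2k − 1` the straight walk (`Zd.straightWalk`) has mass `x_c^X`.
Output constants: `C' = kC`, `c' = min (x_c^{2k}) (x_c^{k−1} c^k 2^{−kC})` (using `a + 1 ≤ X + 1 ≤ 2X`). -/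
theorem stub_steeredChain : CornerCrossingFloor → OneSidedReach := by
  sorry

/-- **S3 `stub_mirrorPin`** — `OneSidedReach → HalfTubePieceFloor` (reflect-and-Schwarz, Madras–Slade Lemma 4.1.12,
applied once; provable now, M).  Given `(C, c)` and `L ≥ 3`, write `L = 2X + 1` or `L = 2X + 2` with `X ≥ 1`.  For
half-walks `ω, ω'` in the `OneSidedReach` family at `X` with the SAME end height `y` (`0 ≤ y ≤ X/5`), the walk `ω`, the
bridging edge(s) `(X, y) → (X+1, y)` (`→ (X+2, y)` for even `L`), then the time-reversed mirror image of `ω'` under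
`x ↦ L − x` (`Zd.reflAt 0 L`) is a self-avoiding walk `0 → (L, 0)` (the halves live in the columns `[0, X]` and
`[L − X, L]`, disjoint), all of whose vertices satisfy `0 ≤ x ≤ L`, `0 ≤ y`, `10 y ≤ 2X ≤ L`; the map `(ω, ω') ↦` glued
walk is injective (cut at the unique crossing of the gap).  Hence, with `A(y)` the partial mass of half-walks ending at
height `y`, the piece mass at `N = 2N_X + 2` is `≥ x_c² Σ_y A(y)² ≥ x_c² (Σ_y A(y))² / (⌊X/5⌋ + 1)`
(`sq_sum_le_card_mul_sum_sq`) `≥ x_c² c² X^{−2C} / (X + 1) ≥ x_c² c² L^{−(2C+1)} / 1` up to the constant from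
`L/3 ≤ X ≤ L`.  `L = 1, 2`: the straight walk, mass `x_c^L`.  Output: `C' = 2C + 1`, `c' = min (x_c²) (x_c² c² 3^{−2C}/2)`
(any such bookkeeping; `x_c ≤ 1` by `Zd.one_le_connectiveConstant`). -/
theorem stub_mirrorPin : OneSidedReach → HalfTubePieceFloor := by
  sorry

/-- **S4 `stub_cornerStaircase`** — `HalfTubePieceFloor → TightTubeFloor` (free corners for one-sided flat pieces;
lattice geometry, provable now, L).  (1) REDUCTIONS: the double sum of `TightTubeFloor` for `(u, v)` equals the one for
`(0, v − u)` (the family is defined through `sawFun 2 n (v − u)` and `u + ω i`; `infDist (u + p) [u, v] =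
infDist p [0, v − u]`), and for `(0, g v)`, `g` one of the 8 lattice isometries fixing `0` (coordinate sign changes
`Zd.reflAt k 0` and the swap `(x, y) ↦ (y, x)`: `ω ↦ g ∘ ω` is a bijection `sawFun n v → sawFun n (g v)` and
`Site.toComplex ∘ g` is a linear isometry of `ℂ` mapping `[0, v]` onto `[0, g v]`); so assume `u = 0`, `v = (a, b)`,
`0 ≤ b ≤ a`, and put `d = |v| ∈ [a, a√2]`, `ℓ₀ = max 1 d`.  (2) SMALL CASE `a < n := 20`: the digital staircase
`x ↦ (x, round(b x / a))` refined to unit steps is a self-avoiding lattice path `0 → v` of `a + b` steps within vertical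
distance `3/2 < 2` of the segment; mass `x_c^{a+b} ≥ x_c^{2n}`.  (3) STAIRCASE `a ≥ n`: corners `Q_j = (x_j, y_j) :=
(⌊j a/n⌋, ⌊j b/n⌋)`, `j = 0..n` (`Δx_j ≥ 1`, `Δy_j ≥ 0`); round `j`: a HORIZONTAL piece of length `Δx_j − 1` from
`Q_{j−1}` (a `HalfTubePieceFloor` walk translated: columns `[x_{j−1}, x_j − 1]`, rows `[y_{j−1}, y_{j−1} + (Δx_j−1)/10]`),
the east edge to `R_j = (x_j, y_{j−1})`, then, if `Δy_j ≥ 1`, a VERTICAL piece of length `Δy_j − 1` from `R_j` (the image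
of a horizontal piece under the swap `(x,y) ↦ (y,x)`, translated: columns `[x_j, x_j + (Δy_j − 1)/10]`, rows
`[y_{j−1}, y_j − 1]`) and the north edge to `Q_j` (pieces of length `0` are single points).  DISJOINTNESS: horizontal
pieces of different rounds are separated by columns (`x_j − 1 < x_j ≤` later columns); a vertical piece `V_j` has columns
`< x_{j+1}` (`(Δy_j − 1)/10 < Δx_{j+1}` since `b ≤ a`) hence is column-separated from all later vertical pieces and from all
horizontal pieces except `H_{j+1}`, from which it is separated by rows (`V_j` rows `≤ y_j − 1 < y_j ≤` rows of `H_{j+1}`);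
so the concatenation (`Zd.concatWalk`, `concatWalk_mem_saws`) is a SAW `0 → v` and the construction is injective (the
corners are prescribed lattice points, each visited once).  TUBE: for a vertex `p`, with `q = (p_x, b p_x / a) ∈ [0, v]`
(`0 ≤ p_x ≤ a`; for the last vertical piece use `q = v`), `|p − q| = |b p_x − a p_y| / a ≤ b/n + 1 + a/(10 n)` on
horizontal pieces (`|b x_j − a y_{j−1}| ≤ a b/n + a`, height `≤ (a/n)/10`) and `≤ b/n + 1 + b/(10 n)` on vertical ones
(the sign of `b p_x − a p_y` runs from `≈ +ab/n` at `R_j` down to `≈ 0` at `Q_j`), both `≤ 1.1 a/n + 1 ≤ d/10 + 2` for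
`n = 20` (`Metric.infDist_le_dist_of_mem`).  MASS: `≤ 2n` pieces of length `≤ a/n + 1 ≤ d`, each `≥ min(c,1) d^{−C}`,
and `≤ 2n − 1` connector edges: partial mass `≥ (x_c min(c,1))^{2n} d^{−2nC}` at `N = Σ N_pieces + 2n`.  Output:
`C' = 2nC`, `c' = (x_c min(c,1))^{2n}` (covers the small case too, `ℓ₀^{−C'} ≤ 1`). -/
theorem stub_cornerStaircase : HalfTubePieceFloor → TightTubeFloor := by
  sorry

/-! ## Proved glue -/

/-- The critical fugacity is nonnegative (`x_c = 1/μ`, `μ ≥ 1`). [folklore] -/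
theorem criticalFugacity_nonneg : 0 ≤ criticalFugacity := by
  have h := Zd.connectiveConstant_pos 2
  rw [Zd.connectiveConstant_two] at h
  unfold criticalFugacity
  exact inv_nonneg.2 h.le

/-- `OneSidedReach` is formally stronger than the `K = 1` instance of the corner-crossing floor's conclusion (the flat
box `[0, X] × [0, X/5]` sits inside `[0, X] × [0, X]`): the content of S2 is the converse direction, the aspect upgrade.
Recorded to make the costume test mechanical (S2 is not a restatement). [folklore] -/
theorem cornerCrossing_one_of_oneSidedReach (h : OneSidedReach) :
    ∃ C c : ℝ, 0 ≤ C ∧ 0 < c ∧ ∀ a : ℕ, 1 ≤ a → ∃ N : ℕ,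
      c * (a : ℝ) ^ (-C) ≤ ∑ n ∈ Finset.range (N + 1),
        ∑ _ω ∈ (Zd.saws 2 n).filter (fun ω =>
            (∀ i ≤ n, 0 ≤ ω i 0 ∧ ω i 0 ≤ (a : ℤ) ∧ 0 ≤ ω i 1 ∧ ω i 1 ≤ (1 : ℤ) * a) ∧ ω n 0 = (a : ℤ)),
          criticalFugacity ^ n := by
  obtain ⟨C, c, hC, hc, h⟩ := h
  refine ⟨C, c, hC, hc, fun a ha => ?_⟩
  obtain ⟨N, hN⟩ := h a ha
  refine ⟨N, hN.trans ?_⟩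
  refine Finset.sum_le_sum fun n _ => ?_
  refine Finset.sum_le_sum_of_subset_of_nonneg ?_ fun _ _ _ => pow_nonneg criticalFugacity_nonneg n
  intro ω hω
  rw [Finset.mem_filter] at hω ⊢
  refine ⟨hω.1, fun i hi => ?_, hω.2.2⟩
  obtain ⟨h0, h1, h2, h3⟩ := hω.2.1 i hi
  exact ⟨h0, h1, h2, by linarith⟩

/-! ## The composition: the four stubs give the crux BY NAME -/

/-- **`TubeLowerBound` from the line `lieb-simon-star`** (kernel-checked, no `sorry` of its own): the corner-crossing
floor S1 is steered into a one-sided reach (S2), pinned by one mirror (S3) into one-sided flat pieces, which the corner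
staircase (S4) assembles in every direction at the scale `ℓ₀ = max(1, |u − v|)`; for `ℓ ≥ ℓ₀` the `ℓ₀`-tube lies inside
the `ℓ`-tube and `c ℓ^{−C} ≤ c ℓ₀^{−C}` (`C ≥ 0`). -/
theorem TubeLowerBound_of : TubeLowerBound := by
  obtain ⟨C, c, hC, hc, h⟩ :=
    stub_cornerStaircase (stub_mirrorPin (stub_steeredChain stub_cornerCrossingFloor))
  refine ⟨C, c, hc, fun u v ℓ hℓ hd => ?_⟩
  obtain ⟨N, hN⟩ := h u v
  set ℓ₀ : ℝ := max 1 (dist (Site.toComplex u) (Site.toComplex v)) with hℓ₀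
  have hℓ₀ℓ : ℓ₀ ≤ ℓ := max_le hℓ hd
  have hℓ₀pos : 0 < ℓ₀ := lt_of_lt_of_le one_pos (le_max_left _ _)
  refine ⟨N, le_trans ?_ (hN.trans ?_)⟩
  · refine mul_le_mul_of_nonneg_left ?_ hc.le
    exact Real.rpow_le_rpow_of_nonpos hℓ₀pos hℓ₀ℓ (by linarith)
  · refine Finset.sum_le_sum fun n _ => ?_
    refine Finset.sum_le_sum_of_subset_of_nonneg ?_ fun _ _ _ => pow_nonneg criticalFugacity_nonneg n
    intro ω hω
    rw [Finset.mem_filter] at hω ⊢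
    refine ⟨hω.1, fun i hi => (hω.2 i hi).trans ?_⟩
    linarith

/-! ## Negative knowledge checked against (landed `Theorems/TubeLowerBound/Negative/*`, imported above) -/

/-- The refuted FIXED-WIDTH variant (tube radius not tied to `|u − v|`): every tube/box in S1–S4 widens linearly with the
span, so no stub is an instance. -/
example : ¬ (∃ C c : ℝ, 0 < c ∧ ∀ (u v : Site 2) (ℓ : ℝ), 1 ≤ ℓ →
    ∃ N : ℕ, c * ℓ ^ (-C) ≤
      Summit.CriticalPhenomena.SAWScalingLimit.Theorems.TubeLowerBound.Negative.tubeMass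
        criticalFugacity u v (ℓ / 10 + 2) N) :=
  Summit.CriticalPhenomena.SAWScalingLimit.Theorems.TubeLowerBound.Negative.not_withoutDist

/-- The crux restated through the landed `tubeMass` (load-bearing module), for reference. -/
example : TubeLowerBound ↔ ∃ C c : ℝ, 0 < c ∧ ∀ (u v : Site 2) (ℓ : ℝ), 1 ≤ ℓ →
    dist (Site.toComplex u) (Site.toComplex v) ≤ ℓ →
      ∃ N : ℕ, c * ℓ ^ (-C) ≤
        Summit.CriticalPhenomena.SAWScalingLimit.Theorems.TubeLowerBound.Negative.tubeMass
          criticalFugacity u v (ℓ / 10 + 2) N :=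
  Summit.CriticalPhenomena.SAWScalingLimit.Theorems.TubeLowerBound.Negative.tubeLowerBound_iff

end Summit.CriticalPhenomena.SAWScalingLimit.Cruxes.TubeLowerBound.LiebSimonStar

end
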